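import Summits.Schanuel.Schanuel.Theorems.RootDecomp1BRadicalDescent06
import Summits.Schanuel.Schanuel.Theorems.RootDecomp1BDefectFloorCellsPi
import Summits.Schanuel.Schanuel.Theorems.RootDecomp1KPiCells
import Literature.Barriers.Schanuel.NesterenkoModularScopeMeasurePi

/-!
# RootDecomp1BNesterenkoRadical — lens 4, generation 33 «NESTERENKO-BASE RADICAL DESCENT» (NesterenkoRadical.lean 10da44fa…, 870 l) — part 1 (RootDecomp1BNesterenkoRadical01): §A the polynomial-size measure class (`polySize_lower_bound`, …) and Nesterenko's triple (mod h52)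

PORT NOTE (census-1 gen 15, 2026-08-31): port of HOME/decomp-schanuel-lens-4/g33/NesterenkoRadical.lean (sha256 10da44fa…3eea, 870 l; own farm rc 0 · 0 warn · 0 sorry ·
axioms std; critic VERDICT STATUS L1718: CHECKLIST B-g33 (1)–(4) incl. (2b) MET, ONE 1B cell-decision credit to lens-4 g33 (B-R20 clause 2: the (π, e^π)-storey of X
decided for the whole ultra class mod ONE registered fact h52); PORT GO LOW, 3 parts) in THREE parts `RootDecomp1BNesterenkoRadical01`–`03`: 01 = §A the polynomial-size
measure class and Nesterenko's triple, 02 = §B the KERNEL `algebraicIndependent_radical_of_polySizeMeasure` (`maxHeartbeats 1600000` as in the source), 03 = §C the cells at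
r = (π, ρπ) and r′ = (ρπ, π), ρ ultra-Liouville, flag data, separation from the earlier storey-two cells, the step cells, `not_liouville_pi` / `not_ultraLiouville_pi`
(hypothesis-free reusable instruments), the named member at ρ_U and the X ⟹ cell shape check. Imports as the kernel (tree RadicalDescent06 + DefectFloorCellsPi + 1KPiCells +
Literature.Barriers.Schanuel.NesterenkoModularScopeMeasurePi); `set_option linter.dupNamespace false` dropped; statements and proofs verbatim; h52 by name.
`--supports stmt-Schanuel-24622`; no census credit. Nothing here proves Schanuel; rung 0. The lens's header follows.
-/

/-!
# RootDecomp1B · lens 4 · generation 33 — «NESTERENKO-BASE RADICAL DESCENT»: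
# the Klein-polar Schanuel inequality X(2) DECIDED at the storey-two cells `r = (π, ρπ)` over the
# TRANSCENDENTAL sharp hyperplane `(π)`, for every ultra-Liouville `ρ`, mod ONE registered print fact
# (LNM 1752 Ch. 3 Cor. 5.2, the measure of algebraic independence of `π, e^π, Γ(1/4)`).

Target (verbatim, `Summit.Schanuel.Schanuel.Theses.RootDecomp1B.KleinPolarSchanuel`, item 24622):
`∀ m (r : Fin m → ℝ), LinearIndependent ℚ r → m + m ≤ trdeg_ℚ ℚ(r, i r, e^{r}, e^{i r})`.

MAIN THEOREMS (this file; `h52 : Literature.Barriers.Schanuel.NesterenkoPhilippon2001_ch3_cor_5_2` BY NAME):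
* §A `PolySizeMeasure θ` — a measure of algebraic independence POLYNOMIAL IN THE SIZE `len P + deg P`, uniform in the
  degree (`‖P(θ)‖ ≥ exp(−μ T^κ)` for `T ≥ len P + deg P + 3`); `polySize_piTriple_explicit h52` (κ = 28 explicit) and
  `polySizeMeasure_piTriple h52` — Cor. 5.2 gives it for `θ = (π, e^π, Γ(1/4))`; `polySize_lower_bound` = step (3)
  of the kernel as a standalone lemma.
* §B KERNEL `algebraicIndependent_radical_of_polySizeMeasure` — g30's radical (Kummer) descent
  (`RootDecomp1BRadicalDescent04.algebraicIndependent_radical`, which needs the degree-doubly-exponential /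
  length-LOGARITHMIC class `DExpMeasure` of Lindemann–Weierstrass type) RE-RUN over the polynomial-size class:
  `PolySizeMeasure θ`, `e^{y₀} = θ_{i₀}`, `ρ > 0` ultra-Liouville ⟹ `(e^{ρ y₀}, ρ, θ)` algebraically independent / ℚ.
  Only step (3) «lower bound from the measure» and the constants of the clash change: the norm form `N = det M(θ)` has
  `len N ≤ q!·E^q ≤ e^{c q²}` and `deg N ≤ q·δ`, so a polynomial-size measure gives `‖N(θ)‖ ≥ exp(−c' e^{κ c q²})`, still
  beaten by the ultra-Liouville smallness `exp(−e^{q³})` of the eigenvalue `q^J P(e^{p y₀/q}, p/q, θ)`.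
* §C THE CELLS.  For every ultra-Liouville `ρ` (a dense `G_δ` of reals; named member `rhoU = Σ 2^{-u_k}` of part 06):
  `e^{ρπ}, ρ, π, e^{π}, Γ(1/4)` are algebraically independent (`algebraicIndependent_five_pi_of_pos`), hence
  `t(π, ρπ) = trdeg ℚ(π, ρπ, iπ, iρπ, e^{π}, e^{ρπ}, −1, e^{iρπ}) ≥ 4 = m + m` (`four_le_polarDeg_pi_ultra`,
  `kleinPolarSchanuel_body_two_pi_ultra` = the body of X at `m = 2, r = (π, ρπ)` verbatim; equivalently SCHANUEL'S
  CONJECTURE ITSELF for the ℚ-free 4-tuple `z = (π, ρπ, iπ, iρπ)`), at BOTH orderings `(π | ρπ)` and `(ρπ | π)`.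
  Flag data, all PROVED: `(π, ρπ)` is ℚ-free (`ρ` irrational), TAME — fed by the direction `π` (`e^{iπ} = −1`),
  so NOT wild (`not_isWild_pi_smul_pi`: the W0-cells at these tuples are vacuous and hold) — and `(π)` is a SHARP
  hyperplane (`t(π) ≤ 2`, tree `polarDeg_pi_le_two`).  Consequently the TAME DEFECT-ZERO STEP T0 (item 32407,
  `TameDefectZeroStep`, status IDEA-NEEDED) has at `(ρπ | π)` an instance whose structural hypotheses
  (ℚ-free, `LastTame`, floor `t ≥ 3`) are ALL THEOREMS and whose conclusion `t ≥ 4` is DECIDED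
  (`tameDefectZeroAt_smul_pi_pi_ultra`, `tameDefectZeroAt_smul_pi_pi_hypotheses`): the first decided T0-cell of the
  1B flag over a transcendental base, and the first storey-two cell of X over a transcendental sharp hyperplane
  (g30/g31: hyperplane `(1)`, mod LW; g32: hyperplanes `(1)`, `(β)` algebraic, mod Roy).  SRL (32406) and the
  1K live link (33363) at these tuples are recorded too.

Nothing here proves Schanuel's conjecture or X; rung 0.  0 sorry; axioms standard; `h52` is the only named fact used
(the qualitative `Literature.NumberTheory.Transcendental.nesterenko` is NOT used).
-/

noncomputable section

open Complex

namespace Summit.Schanuel.Schanuel.Theorems.RootDecomp1BNesterenkoRadical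

open Summit.Schanuel.Schanuel.Theorems.RootDecomp1BRadicalDescent

/-! ## §A  The polynomial-size measure class and Nesterenko's triple -/

section Measure

open MvPolynomial
open Summit.Schanuel.Schanuel.Theorems.RootDecomp1KHyper (mvlen mvlen_nonneg abs_coeff_le_mvlen one_le_mvlen)
open Summit.Schanuel.Schanuel.Theorems.RootDecomp1KHyper.HyperCell (natAbs_coeff_sup_le_mvlen)
open Literature.Barriers.Schanuel (NesterenkoPhilippon2001_ch3_cor_5_2 NesterenkoPhilippon2001_ch3_cor_5_2_pi_of)

variable {n : ℕ}

/-- **`PolySizeMeasure θ`** — a measure of algebraic independence of the tuple `θ`, POLYNOMIAL IN THE SIZE and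
UNIFORM IN THE DEGREE: there are `μ > 0`, `κ` with `exp(−μ T^κ) ≤ ‖P(θ)‖` for every non-zero integer `P` and every
`T ≥ len P + deg P + 3` (`len` = sum of the moduli of the coefficients, `deg` = total degree). -/
def PolySizeMeasure (θ : Fin n → ℂ) : Prop :=
  ∃ (μ : ℝ) (κ : ℕ), 0 < μ ∧ ∀ P : MvPolynomial (Fin n) ℤ, P ≠ 0 → ∀ T : ℝ,
    ((mvlen P : ℤ) : ℝ) + (P.totalDegree : ℝ) + 3 ≤ T → Real.exp (-(μ * T ^ κ)) ≤ ‖MvPolynomial.aeval θ P‖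

/-- **LNM 1752 Ch. 3 Cor. 5.2 ⟹ the polynomial-size bound for `(π, e^π, Γ(1/4))` with the EXPLICIT exponent
`κ = 28`** (`T⁴ (log T)²⁴ ≤ T²⁸` for `T ≥ 1`; `max(H + deg, e) ≤ len + deg + 3`, the height–length comparison being
the tree's `HyperCell.natAbs_coeff_sup_le_mvlen`). -/
theorem polySize_piTriple_explicit (h52 : NesterenkoPhilippon2001_ch3_cor_5_2) :
    ∃ μ : ℝ, 0 < μ ∧ ∀ P : MvPolynomial (Fin 3) ℤ, P ≠ 0 → ∀ T : ℝ,
      ((mvlen P : ℤ) : ℝ) + (P.totalDegree : ℝ) + 3 ≤ T → Real.exp (-(μ * T ^ 28)) ≤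
        ‖MvPolynomial.aeval ![(Real.pi : ℂ), cexp (Real.pi : ℂ), (Real.Gamma (1 / 4) : ℂ)] P‖ := by
  obtain ⟨μ, hμ, hA⟩ := NesterenkoPhilippon2001_ch3_cor_5_2_pi_of h52
  refine ⟨μ, hμ, fun P hP T hT => ?_⟩
  have hL1 : (1 : ℝ) ≤ ((mvlen P : ℤ) : ℝ) := by exact_mod_cast one_le_mvlen hP
  have hD0 : (0 : ℝ) ≤ (P.totalDegree : ℝ) := Nat.cast_nonneg _
  have hT4 : 4 ≤ T := by linarith
  have hHT : max (((P.support.sup fun m => (P.coeff m).natAbs : ℕ) : ℝ) + (P.totalDegree : ℝ))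
      (Real.exp 1) ≤ T := by
    refine max_le ?_ ?_
    · have h1 := natAbs_coeff_sup_le_mvlen P
      rw [Int.cast_natCast] at h1
      linarith
    · have := Real.exp_one_lt_d9
      linarith
  refine le_trans ?_ (hA P hP T hHT)
  rw [Real.exp_le_exp, neg_le_neg_iff]
  have hT0 : 0 < T := by linarith
  have hlogT : Real.log T ≤ T := (Real.log_le_sub_one_of_pos hT0).trans (by linarith)
  have hlog0 : 0 ≤ Real.log T := Real.log_nonneg (by linarith)
  calc μ * T ^ 4 * Real.log T ^ 24 ≤ μ * T ^ 4 * T ^ 24 := by gcongr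
    _ = μ * T ^ 28 := by ring

/-- **Cor. 5.2 ⟹ `PolySizeMeasure (π, e^π, Γ(1/4))`.** -/
theorem polySizeMeasure_piTriple (h52 : NesterenkoPhilippon2001_ch3_cor_5_2) :
    PolySizeMeasure ![(Real.pi : ℂ), cexp (Real.pi : ℂ), (Real.Gamma (1 / 4) : ℂ)] := by
  obtain ⟨μ, hμ, h⟩ := polySize_piTriple_explicit h52
  exact ⟨μ, 28, hμ, h⟩

/-- **Step (3) of the kernel, standalone** (also a port aid: keeps the kernel theorem under the 398-line part cap):
the polynomial-size measure evaluated at the size parameter `T = (δ + 4)·e^{c_N q²} ≥ len N + deg N + 3`, for a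
polynomial `N ≠ 0` with `len N ≤ e^{q²}·e^{c_E q²}` and `deg N ≤ q·δ`; the constants are passed as the equations the
kernel holds (`c_N = c_E + 2`, `a = κ c_N`, `c_M = μ (δ + 4)^κ`, `A = 2`). -/
theorem polySize_lower_bound {θ : Fin n → ℂ} {cμ : ℝ} {κ : ℕ}
    (hMeas : ∀ P : MvPolynomial (Fin n) ℤ, P ≠ 0 → ∀ T : ℝ,
      ((mvlen P : ℤ) : ℝ) + (P.totalDegree : ℝ) + 3 ≤ T → Real.exp (-(cμ * T ^ κ)) ≤ ‖MvPolynomial.aeval θ P‖)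
    {N : MvPolynomial (Fin n) ℤ} (hN0 : N ≠ 0) {q δe A : ℕ} {cE cN a cM : ℝ}
    (hcE0 : 0 ≤ cE) (hcN : cN = cE + 2) (ha : a = (κ : ℝ) * cN) (hcM : cM = cμ * ((δe : ℝ) + 4) ^ κ)
    (hA : A = 2) (hcM0 : 0 ≤ cM) (hq2 : (1 : ℝ) ≤ (q : ℝ) ^ 2) (hqsq : (q : ℝ) ≤ (q : ℝ) ^ 2)
    (hlenq : ((mvlen N : ℤ) : ℝ) ≤ Real.exp ((q : ℝ) ^ 2) * Real.exp (cE * (q : ℝ) ^ 2))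
    (hNdeg : (N.totalDegree : ℝ) ≤ (q : ℝ) * δe) :
    Real.exp (-(cM * (q : ℝ) ^ 2 * Real.exp (a * (q : ℝ) ^ A))) ≤ ‖MvPolynomial.aeval θ N‖ := by
  have hcN1 : (1 : ℝ) ≤ cN := by rw [hcN]; linarith only [hcE0]
  have hq20 : (0 : ℝ) ≤ (q : ℝ) ^ 2 := by positivity
  have hcN0 : (0 : ℝ) ≤ cN := by linarith only [hcN1]
  have heN : (1 : ℝ) ≤ Real.exp (cN * (q : ℝ) ^ 2) := Real.one_le_exp (mul_nonneg hcN0 hq20)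
  have hlen : ((mvlen N : ℤ) : ℝ) ≤ Real.exp (cN * (q : ℝ) ^ 2) := by
    rw [← Real.exp_add] at hlenq
    refine hlenq.trans ?_
    rw [Real.exp_le_exp]
    have t : cN * (q : ℝ) ^ 2 = (q : ℝ) ^ 2 + cE * (q : ℝ) ^ 2 + (q : ℝ) ^ 2 := by rw [hcN]; ring
    linarith only [t, hq20]
  have hdeg : (N.totalDegree : ℝ) + 3 ≤ ((δe : ℝ) + 3) * Real.exp (cN * (q : ℝ) ^ 2) := by
    have h2 : (q : ℝ) ≤ Real.exp (cN * (q : ℝ) ^ 2) := by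
      have h0 : (q : ℝ) ≤ Real.exp (q : ℝ) := by linarith only [Real.add_one_le_exp (q : ℝ)]
      refine h0.trans ?_
      rw [Real.exp_le_exp]
      exact hqsq.trans (le_mul_of_one_le_left hq20 hcN1)
    have hδ0 : (0 : ℝ) ≤ δe := Nat.cast_nonneg _
    have h3 : (q : ℝ) * δe ≤ Real.exp (cN * (q : ℝ) ^ 2) * δe := mul_le_mul_of_nonneg_right h2 hδ0
    have t : ((δe : ℝ) + 3) * Real.exp (cN * (q : ℝ) ^ 2) =
        Real.exp (cN * (q : ℝ) ^ 2) * δe + 3 * Real.exp (cN * (q : ℝ) ^ 2) := by ring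
    linarith only [hNdeg, h3, heN, t]
  obtain ⟨T, hT⟩ : ∃ T : ℝ, T = ((δe : ℝ) + 4) * Real.exp (cN * (q : ℝ) ^ 2) := ⟨_, rfl⟩
  have hTN : ((mvlen N : ℤ) : ℝ) + (N.totalDegree : ℝ) + 3 ≤ T := by
    have t : T = Real.exp (cN * (q : ℝ) ^ 2) + ((δe : ℝ) + 3) * Real.exp (cN * (q : ℝ) ^ 2) := by
      rw [hT]; ring
    linarith only [hlen, hdeg, t]
  refine le_trans ?_ (hMeas N hN0 T hTN)
  rw [Real.exp_le_exp, neg_le_neg_iff]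
  have hTpow : T ^ κ = ((δe : ℝ) + 4) ^ κ * Real.exp (a * (q : ℝ) ^ A) := by
    rw [hT, mul_pow, ← Real.exp_nat_mul, ha, hA]
    congr 1
    congr 1
    ring
  have hE0 : 0 ≤ cM * Real.exp (a * (q : ℝ) ^ A) := mul_nonneg hcM0 (Real.exp_pos _).le
  calc cμ * T ^ κ = cM * Real.exp (a * (q : ℝ) ^ A) := by rw [hTpow, hcM]; ring
    _ = cM * Real.exp (a * (q : ℝ) ^ A) * 1 := (mul_one _).symm
    _ ≤ cM * Real.exp (a * (q : ℝ) ^ A) * (q : ℝ) ^ 2 := mul_le_mul_of_nonneg_left hq2 hE0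
    _ = cM * (q : ℝ) ^ 2 * Real.exp (a * (q : ℝ) ^ A) := by ring

end Measure

end Summit.Schanuel.Schanuel.Theorems.RootDecomp1BNesterenkoRadical

end
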